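import Literature.NumberTheory.Automorphic.RankinSelbergTorusPointwise
import Literature.NumberTheory.Automorphic.WhittakerTowerBridge
import Literature.NumberTheory.Automorphic.WhittakerTowerCoeff
import Literature.NumberTheory.Automorphic.CuspFormFourierExpansionGL2Inputs
import Literature.NumberTheory.Automorphic.AutomorphicFormsGLContinuous
import Literature.NumberTheory.Automorphic.GlobalWhittakerCoefficientProofs
import HarnessLib

/-!
# Cusp forms on `GL_n(𝔸_K)` are generic, for every `n`, every Haar measure, every fundamental domain
and every global character (Shalika (1974), Thm. 5.9; Cogdell (2004), §1.1–§1.2)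

Topic `NumberTheory/Automorphic`; namespace `Literature.NumberTheory.Automorphic`. Proof file
(theorems only: no definition, no named fact). The named fact `Shalika1974_fourierExpansion_cuspForm`
of `GlobalWhittakerCoefficient` and its in-file corollary `whittakerCoeff_ne_zero_of_fourierExpansion`
(global genericity) are stated for the global `ψ`-Whittaker coefficient `whittakerCoeff ν 𝓕 ψ φ` with
*every* Haar measure `ν` of `N_n(𝔸_K)` (for any Borel structure), *every* fundamental domain `𝓕` of
`N_n(K)` and *every* global additive character `ψ`, whereas the column-by-column Fourier–Whittaker
tower of the tree (`WhittakerTower`, …, `WhittakerTowerCoeff`, `CuspidalTowerGeneric`) computes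
`Φ_0 = whittakerDepth 0 φ` with Tate's character `ψ_K = adeleAddChar K` and Tate's box. This file
bridges the two normalisations and draws the genericity of honest cusp forms, for all `n`:

* `ratGL_dilationDiagonal` — the dilation matrix `d_η = diag(η^{n-1}, …, η, 1)` of
  `whittakerCoeff_mulShift` (`RankinSelbergTorusPointwise`) is the diagonal image of a rational
  matrix;
* `exists_whittakerCoeff_eq_whittakerCoeff_adeleAddChar` — **`W^ψ_{ν,𝓕} = W^{ψ_K}_{ν,𝓕}(d_η ·)` for
  some `η ∈ Kˣ`**: every global `ψ` is `ψ_K(η ·)` (`IsGlobalAddChar.exists_eq_mulShift`, Tate's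
  `K^⊥ = K`) and changing the character is a rational torus translate (`whittakerCoeff_mulShift`;
  Cogdell (2004), §1.1: "`W_{φ,ψ_γ}(g) = W_{φ,ψ}(diag(γ,1) g)`");
* `whittakerCoeff_adeleAddChar_eq_whittakerDepth_zero` — **`W^{ψ_K}_{ν,𝓕} = Φ_0`** for `φ`
  continuous and left `GL_n(K)`-invariant, `1 ≤ n`, every Haar `ν` on any Borel structure of
  `N_n(𝔸_K)` and every fundamental domain `𝓕` (independence of the fundamental domain,
  `whittakerCoeff_eq_of_isFundamentalDomain`; `whittakerDepth_zero_eq_whittakerCoeff`; all Borel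
  structures of `N_n(𝔸_K)` coincide); with the previous item,
  `exists_whittakerCoeff_eq_whittakerDepth_zero`: `W^ψ_{ν,𝓕} = Φ_0(d_η ·)`;
* `IsCuspFormGL.eq_zero_of_whittakerCoeff_eq_zero`, `exists_whittakerCoeff_ne_zero_of_isCuspFormGL`
  (**main**) — **a cusp form on `GL_n(𝔸_K)` (`IsCuspFormGL`, Borel–Jacquet) all of whose
  `ψ`-Whittaker coefficients vanish is zero; a non-zero cusp form has a non-zero Whittaker
  coefficient** (Shalika (1974), Thm. 5.9; Cogdell (2004), §1.2: "`𝒲(π, ψ) ≠ 0` and `π` is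
  (globally) generic"), for every `n`, from the mean-square genericity of the tower
  (`eq_zero_of_whittakerDepth_zero_eq_zero`, `WhittakerTowerBridge`); `n = 0` is `W_φ = φ`
  (`GlobalWhittakerCoefficientProofs`). This is the conclusion of
  `whittakerCoeff_ne_zero_of_fourierExpansion` without its hypothesis
  `Shalika1974_fourierExpansion_cuspForm` (and without `MeasurableSet 𝓕`); the smoothed-`L²` version
  is `SmoothedCuspFormGeneric`.

## References

* J. A. Shalika, *The multiplicity one theorem for GL_n*, Ann. of Math. 100 (1974), §5, Thm. 5.9
  [Shalika1974].
* J. W. Cogdell, *Analytic theory of L-functions for GL_n*, in J. Bernstein, S. Gelbart (eds.),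
  *An Introduction to the Langlands Program* (2004), §1.1 (PDF p. 176 of the held copy), §1.2
  [CogdellAnalyticTheory2004].
-/

noncomputable section

open MeasureTheory Measure NumberField IsDedekindDomain Matrix Set
open scoped MatrixGroups ComplexConjugate ENNReal

namespace Literature.NumberTheory.Automorphic

/-! ### The dilation matrix is rational -/

section Dilation

variable {n : ℕ} {K : Type} [Field K] [NumberField K]

/-- **The dilation matrix is rational**: `diag(η^{n-1}, …, η, 1) ∈ GL_n(𝔸_K)` (principal ideles on
the diagonal) is the diagonal image `ratGL` of the rational diagonal matrix with the same weights.
[folklore] -/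
theorem ratGL_dilationDiagonal (η : Kˣ) :
    ratGL K (glDiagonal n K fun i : Fin n => η ^ (n - 1 - (i : ℕ))) =
      glDiagonal n (AdeleRing (𝓞 K) K) fun i : Fin n =>
        GaloisRepresentations.principalIdele K (η ^ (n - 1 - (i : ℕ))) := by
  refine Units.ext ?_
  ext i j
  rw [ratGL_apply, coe_glDiagonal, coe_glDiagonal, Matrix.diagonal_apply, Matrix.diagonal_apply]
  split_ifs
  · rfl
  · exact map_zero _

/-- The dilation matrix lies in the arithmetic subgroup `GL_n(K)` of `GL_n(𝔸_K)`. [folklore] -/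
theorem dilationDiagonal_mem_arithmeticSubgroup (η : Kˣ) :
    (glDiagonal n (AdeleRing (𝓞 K) K) fun i : Fin n =>
        GaloisRepresentations.principalIdele K (η ^ (n - 1 - (i : ℕ)))) ∈
      (AdelicGroupData.gl n K).arithmeticSubgroup :=
  ⟨_, ratGL_dilationDiagonal η⟩

variable [MeasurableSpace ↥(adelicUnipotent n K)] [BorelSpace ↥(adelicUnipotent n K)]

/-- **Every global Whittaker coefficient is a Tate-normalised one at a rational torus translate**:
for a global additive character `ψ`, a Haar measure `ν` of `N_n(𝔸_K)`, a fundamental domain `𝓕` of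
`N_n(K)` and `φ` left `GL_n(K)`-invariant there is `η ∈ Kˣ` with
`W^ψ_{ν,𝓕}(h) = W^{ψ_K}_{ν,𝓕}(d_η h)` for all `h`, `d_η = diag(η^{n-1}, …, η, 1)` rational
(`ψ = ψ_K(η ·)` by `IsGlobalAddChar.exists_eq_mulShift`, then `whittakerCoeff_mulShift`; Cogdell
(2004), §1.1). [cite: CogdellAnalyticTheory2004, §1.1] -/
theorem exists_whittakerCoeff_eq_whittakerCoeff_adeleAddChar (ν : Measure ↥(adelicUnipotent n K))
    [IsHaarMeasure ν] {𝓕 : Set ↥(adelicUnipotent n K)}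
    (h𝓕 : IsFundamentalDomain ↥(rationalUnipotent n K) 𝓕 ν)
    {ψ : AddChar (AdeleRing (𝓞 K) K) Circle} (hψ : IsGlobalAddChar K ψ)
    {φ : GL (Fin n) (AdeleRing (𝓞 K) K) → ℂ} (hφ : IsLeftInvariant (AdelicGroupData.gl n K) φ) :
    ∃ η : Kˣ, ∀ h : GL (Fin n) (AdeleRing (𝓞 K) K),
      whittakerCoeff ν 𝓕 ψ φ h = whittakerCoeff ν 𝓕 (adeleAddChar K) φ
        (ratGL K (glDiagonal n K fun i : Fin n => η ^ (n - 1 - (i : ℕ))) * h) := by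
  obtain ⟨η, hη0, hψη⟩ := hψ.exists_eq_mulShift
  refine ⟨Units.mk0 η hη0, fun h => ?_⟩
  rw [hψη, ratGL_dilationDiagonal]
  exact whittakerCoeff_mulShift ν h𝓕 (isGlobalAddChar_adeleAddChar K) hφ (Units.mk0 η hη0) h

end Dilation

/-! ### From `whittakerCoeff` to the tower's `Φ_0 = whittakerDepth 0` -/

section Depth

variable {n : ℕ} {K : Type} [Field K] [NumberField K]

/-- **`W^{ψ_K}_{ν,𝓕} = Φ_0`**: for `φ` continuous and left `GL_n(K)`-invariant, `1 ≤ n`, every Haar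
measure `ν` of `N_n(𝔸_K)` (for any Borel structure on it) and every fundamental domain `𝓕` of
`N_n(K)`, `whittakerCoeff ν 𝓕 ψ_K φ g = whittakerDepth 0 φ g` (independence of the fundamental
domain, `whittakerCoeff_eq_of_isFundamentalDomain`, and `whittakerDepth_zero_eq_whittakerCoeff` of
`WhittakerTowerCoeff` on Tate's box; the Borel structures of `N_n(𝔸_K)` all coincide with the one
induced from `GL_n(𝔸_K)`). [cite: CogdellAnalyticTheory2004, §1.1] -/
theorem whittakerCoeff_adeleAddChar_eq_whittakerDepth_zero
    [MeasurableSpace (GL (Fin n) (AdeleRing (𝓞 K) K))] [BorelSpace (GL (Fin n) (AdeleRing (𝓞 K) K))]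
    [mN : MeasurableSpace ↥(adelicUnipotent n K)] [hN : BorelSpace ↥(adelicUnipotent n K)]
    (ν : Measure ↥(adelicUnipotent n K)) [IsHaarMeasure ν] {𝓕 : Set ↥(adelicUnipotent n K)}
    (h𝓕 : IsFundamentalDomain ↥(rationalUnipotent n K) 𝓕 ν)
    {φ : GL (Fin n) (AdeleRing (𝓞 K) K) → ℂ} (hφ : IsLeftInvariant (AdelicGroupData.gl n K) φ)
    (hφc : Continuous φ) (hn : 1 ≤ n) (g : GL (Fin n) (AdeleRing (𝓞 K) K)) :
    whittakerCoeff ν 𝓕 (adeleAddChar K) φ g = whittakerDepth 0 φ g := by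
  -- the two Borel structures on `N_n(𝔸_K)` coincide
  have hm : mN = @Subtype.instMeasurableSpace (GL (Fin n) (AdeleRing (𝓞 K) K))
      (· ∈ adelicUnipotent n K) ‹MeasurableSpace (GL (Fin n) (AdeleRing (𝓞 K) K))› := by
    rw [hN.measurable_eq]
    exact (@BorelSpace.measurable_eq ↥(adelicUnipotent n K) _ _ (Subtype.borelSpace _)).symm
  subst hm
  rw [whittakerCoeff_eq_of_isFundamentalDomain h𝓕 (isFundamentalDomain_unipotentTateDomain ν)
    (isGlobalAddChar_adeleAddChar K) hφ g]
  exact (whittakerDepth_zero_eq_whittakerCoeff hφc hn ν g).symm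

/-- **`W^ψ_{ν,𝓕} = Φ_0(d_η ·)`**: for `φ` continuous and left `GL_n(K)`-invariant, `1 ≤ n`, a global
`ψ`, a Haar `ν` and a fundamental domain `𝓕`, there is `η ∈ Kˣ` with
`whittakerCoeff ν 𝓕 ψ φ g = whittakerDepth 0 φ (d_η g)` for all `g`, `d_η = diag(η^{n-1}, …, η, 1)`
rational. [cite: CogdellAnalyticTheory2004, §1.1] -/
theorem exists_whittakerCoeff_eq_whittakerDepth_zero
    [MeasurableSpace (GL (Fin n) (AdeleRing (𝓞 K) K))] [BorelSpace (GL (Fin n) (AdeleRing (𝓞 K) K))]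
    [MeasurableSpace ↥(adelicUnipotent n K)] [BorelSpace ↥(adelicUnipotent n K)]
    (ν : Measure ↥(adelicUnipotent n K)) [IsHaarMeasure ν] {𝓕 : Set ↥(adelicUnipotent n K)}
    (h𝓕 : IsFundamentalDomain ↥(rationalUnipotent n K) 𝓕 ν)
    {ψ : AddChar (AdeleRing (𝓞 K) K) Circle} (hψ : IsGlobalAddChar K ψ)
    {φ : GL (Fin n) (AdeleRing (𝓞 K) K) → ℂ} (hφ : IsLeftInvariant (AdelicGroupData.gl n K) φ)
    (hφc : Continuous φ) (hn : 1 ≤ n) :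
    ∃ η : Kˣ, ∀ g : GL (Fin n) (AdeleRing (𝓞 K) K),
      whittakerCoeff ν 𝓕 ψ φ g =
        whittakerDepth 0 φ (ratGL K (glDiagonal n K fun i : Fin n => η ^ (n - 1 - (i : ℕ))) * g) := by
  obtain ⟨η, hη⟩ := exists_whittakerCoeff_eq_whittakerCoeff_adeleAddChar ν h𝓕 hψ hφ
  exact ⟨η, fun g => by
    rw [hη g, whittakerCoeff_adeleAddChar_eq_whittakerDepth_zero ν h𝓕 hφ hφc hn]⟩

end Depth

/-! ### Genericity of cusp forms on `GL_n`, for every `n` -/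

section Generic

variable {n : ℕ} {K : Type} [Field K] [NumberField K]
variable [MeasurableSpace ↥(adelicUnipotent n K)] [BorelSpace ↥(adelicUnipotent n K)]

-- `AutomorphyDatum.gl` lives over the coefficient algebra `mixedSpace K`, whose `Fintype` instances
-- need classical decidability (as in `GlobalWhittakerCoefficient`, H5).
open scoped Classical in
/-- **A cusp form with vanishing Whittaker coefficients is zero** (Shalika (1974), Thm. 5.9;
Cogdell (2004), §1.2), for every `n`, every Haar measure `ν` of `N_n(𝔸_K)`, every fundamental domain
`𝓕` of `N_n(K)` and every global additive character `ψ`: if `φ` is a cusp form on `GL_n(𝔸_K)`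
(`IsCuspFormGL`) with `W^ψ_{ν,𝓕}(g) = 0` for all `g`, then `φ = 0`. For `n = 0` this is `W_φ = φ`
(`whittakerCoeff_eq_self_of_le_one`); for `n ≥ 1`, `W^ψ_{ν,𝓕} = Φ_0(d_η ·)`
(`exists_whittakerCoeff_eq_whittakerDepth_zero`), so `Φ_0 ≡ 0`, and the mean-square genericity of the
tower (`eq_zero_of_whittakerDepth_zero_eq_zero`, `WhittakerTowerBridge`) applies to the continuous,
left `GL_n(K)`-invariant, cuspidal `φ`. [cite: Shalika1974, §5 Thm. 5.9] -/
theorem IsCuspFormGL.eq_zero_of_whittakerCoeff_eq_zero (ν : Measure ↥(adelicUnipotent n K))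
    [IsHaarMeasure ν] {𝓕 : Set ↥(adelicUnipotent n K)}
    (h𝓕 : IsFundamentalDomain ↥(rationalUnipotent n K) 𝓕 ν)
    {ψ : AddChar (AdeleRing (𝓞 K) K) Circle} (hψ : IsGlobalAddChar K ψ)
    {φ : GL (Fin n) (AdeleRing (𝓞 K) K) → ℂ}
    (hφ : IsCuspFormGL n K (isCompact_glFiniteIntegralLevel_holds n K) φ)
    (hW : ∀ g, whittakerCoeff ν 𝓕 ψ φ g = 0) : φ = 0 := by
  funext x
  rcases Nat.lt_or_ge n 1 with hn | hn
  · -- `n = 0`: `W_φ = φ`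
    have hn1 : n ≤ 1 := by omega
    rw [← whittakerCoeff_eq_self_of_le_one hn1 ν (measure_fundamentalDomain_ne_zero_of_le_one hn1 ν h𝓕)
      (measure_ne_top_of_le_one hn1 ν 𝓕) ψ φ x]
    exact hW x
  · -- `n ≥ 1`: through the tower
    borelize (GL (Fin n) (AdeleRing (𝓞 K) K))
    borelize (AdeleRing (𝓞 K) K)
    have hl : IsLeftInvariant (AdelicGroupData.gl n K) φ := hφ.1.leftInvariant
    have hφc : Continuous φ := hφ.1.continuous_gl
    obtain ⟨η, hη⟩ := exists_whittakerCoeff_eq_whittakerDepth_zero ν h𝓕 hψ hl hφc hn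
    have h0 : ∀ y : GL (Fin n) (AdeleRing (𝓞 K) K), whittakerDepth 0 φ y = 0 := fun y => by
      have e : y = ratGL K (glDiagonal n K fun i : Fin n => η ^ (n - 1 - (i : ℕ))) *
          ((ratGL K (glDiagonal n K fun i : Fin n => η ^ (n - 1 - (i : ℕ))))⁻¹ * y) := by group
      rw [e, ← hη]
      exact hW _
    exact eq_zero_of_whittakerDepth_zero_eq_zero hφc (fun δ y => hl _ ⟨δ, rfl⟩ y) hφ.2 h0 x

open scoped Classical in
/-- **Cusp forms on `GL_n(𝔸_K)` are globally generic, for every `n`** (Shalika (1974), Thm. 5.9;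
Piatetski-Shapiro; Cogdell (2004), §1.2: "`𝒲(π, ψ) ≠ 0` and `π` is (globally) generic"): a non-zero
cusp form on `GL_n(𝔸_K)` has a non-zero global `ψ`-Whittaker coefficient, for every Haar measure of
`N_n(𝔸_K)`, every fundamental domain of `N_n(K)` and every global additive character `ψ`. This is
the conclusion of `whittakerCoeff_ne_zero_of_fourierExpansion` (`GlobalWhittakerCoefficient`)
without the hypothesis `Shalika1974_fourierExpansion_cuspForm`. [cite: Shalika1974, §5 Thm. 5.9] -/
theorem exists_whittakerCoeff_ne_zero_of_isCuspFormGL (ν : Measure ↥(adelicUnipotent n K))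
    [IsHaarMeasure ν] {𝓕 : Set ↥(adelicUnipotent n K)}
    (h𝓕 : IsFundamentalDomain ↥(rationalUnipotent n K) 𝓕 ν)
    {ψ : AddChar (AdeleRing (𝓞 K) K) Circle} (hψ : IsGlobalAddChar K ψ)
    {φ : GL (Fin n) (AdeleRing (𝓞 K) K) → ℂ}
    (hφ : IsCuspFormGL n K (isCompact_glFiniteIntegralLevel_holds n K) φ) (hφ0 : φ ≠ 0) :
    ∃ g, whittakerCoeff ν 𝓕 ψ φ g ≠ 0 := by
  by_contra h
  push Not at h
  exact hφ0 (hφ.eq_zero_of_whittakerCoeff_eq_zero ν h𝓕 hψ h)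

end Generic

end Literature.NumberTheory.Automorphic
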